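import Literature.Analysis.FluidPDE.EnergySpaceRellich
import Mathlib.MeasureTheory.Measure.ProbabilityMeasure
import HarnessLib

/-!
# Stub S0 `stub_lscEnstrophy` for line `dissipation-deficit-duality`
# (crux `TaylorCertificates.FloorCertificate`, stmt-AnomalousDissipation-14091)

The mean enstrophy `μ ↦ ∫⁻ ‖∇u‖² dμ` (`Torus.ensembleEnstrophy`) is lower semicontinuous on
`ProbabilityMeasure H`, `H = Torus.energySpace d` with its norm topology and Borel σ-algebra,
for the topology of weak convergence of probability measures.

Proof. The spectral enstrophy `u ↦ ‖∇u‖² = 4π² ∑ₖ |k|² ‖û(k)‖²` (`Torus.eGradNormSq_eq_tsum`)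
is the monotone supremum over `N : ℕ` of the bounded continuous functions
`g_N(u) = min (N, 4π² ∑_{|k|² ≤ N} |k|² ‖û(k)‖²)` (each coefficient map `u ↦ û(k)` is continuous
on `H`, `Torus.continuous_mFourierCoeff_complexify_coe`). By monotone convergence
`∫⁻ ‖∇u‖² dμ = ⨆_N ∫⁻ g_N dμ`; each `μ ↦ ∫⁻ g_N dμ` is continuous on `ProbabilityMeasure H`
(`ProbabilityMeasure.continuous_lintegral_boundedContinuousFunction`), and a supremum of
continuous functions is lower semicontinuous (`lowerSemicontinuous_iSup`).
-/

noncomputable section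

set_option linter.dupNamespace false

namespace Summit.AnomalousDissipation.AnomalousDissipation.Theorems.TaylorCertificatesFloorCertificate

open MeasureTheory Filter Topology UnitAddTorus
open scoped ENNReal NNReal BoundedContinuousFunction
open Literature.Analysis.FunctionSpaces Literature.Analysis.FluidPDE

/-- Local notation for the real Hilbert space `L²(T^d; ℝ^d)`. -/
local notation "L2T " d':max => Lp (EuclideanSpace ℝ d') 2 (volume : Measure (UnitAddTorus d'))

/-- Local notation for vector fields on `T^d`. -/
local notation "Vec " d':max => UnitAddTorus d' → EuclideanSpace ℝ d'

/-- **Truncated spectral approximation of the enstrophy.** There is a monotone sequence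
`g_N : H → [0, ∞]` of continuous functions with `g_N ≤ N` whose pointwise supremum is the
spectral enstrophy `u ↦ ‖∇u‖² = 4π² ∑ₖ |k|² ‖û(k)‖²`; namely
`g_N(u) = min (N, 4π² ∑_{|k|² ≤ N} |k|² ‖û(k)‖²)`. [folklore] -/
theorem exists_continuous_monotone_iSup_eq_eGradNormSq {d : Type*} [Fintype d] [DecidableEq d] :
    ∃ g : ℕ → Torus.energySpace d → ℝ≥0∞,
      (∀ N, Continuous (g N)) ∧ (∀ N u, g N u ≤ N) ∧ Monotone g ∧
      ∀ u : Torus.energySpace d, ⨆ N, g N u = Torus.eGradNormSq ((u : L2T d) : Vec d) := by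
  set C : ℝ≥0∞ := ENNReal.ofReal (4 * Real.pi ^ 2) with hC
  set F : Torus.energySpace d → (d → ℤ) → ℝ≥0∞ := fun u k =>
    ENNReal.ofReal (Torus.freqNormSq k) *
      ‖mFourierCoeff (Literature.Analysis.FunctionSpaces.EuclideanSpace.complexify ∘
        ((u : L2T d) : Vec d)) k‖ₑ ^ 2
    with hF
  have hF_cont : ∀ k, Continuous fun u => F u k := fun k =>
    (ENNReal.continuous_const_mul ENNReal.ofReal_ne_top).comp
      ((ENNReal.continuous_pow 2).comp
        ((Torus.continuous_mFourierCoeff_complexify_coe k).comp continuous_subtype_val).enorm)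
  have hF_ne_top : ∀ u k, F u k ≠ ∞ := fun u k =>
    ENNReal.mul_ne_top ENNReal.ofReal_ne_top (ENNReal.pow_ne_top enorm_ne_top)
  set s : ℕ → Finset (d → ℤ) := fun N => (Torus.finite_setOf_freqNormSq_le N).toFinset with hs
  have hs_mono : Monotone s := by
    intro M N hMN k hk
    simp only [hs, Set.Finite.mem_toFinset, Set.mem_setOf_eq] at hk ⊢
    exact hk.trans (by exact_mod_cast hMN)
  have hs_exhaust : ∀ t : Finset (d → ℤ), ∃ N, t ⊆ s N := by
    intro t
    obtain ⟨N, hN⟩ := exists_nat_ge (∑ k ∈ t, Torus.freqNormSq k)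
    refine ⟨N, fun k hk => ?_⟩
    simp only [hs, Set.Finite.mem_toFinset, Set.mem_setOf_eq]
    exact (Finset.single_le_sum (fun j _ => Torus.freqNormSq_nonneg j) hk).trans hN
  set g : ℕ → Torus.energySpace d → ℝ≥0∞ := fun N u => min (N : ℝ≥0∞) (C * ∑ k ∈ s N, F u k)
    with hg
  refine ⟨g, fun N => ?_, fun N u => min_le_left _ _, ?_, fun u => ?_⟩
  · exact continuous_const.min ((ENNReal.continuous_const_mul ENNReal.ofReal_ne_top).comp
      (continuous_finsetSum (s N) fun k _ => hF_cont k))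
  · intro M N hMN u
    exact min_le_min (by exact_mod_cast hMN)
      (mul_le_mul_right (Finset.sum_le_sum_of_subset (hs_mono hMN)) _)
  · rw [Torus.eGradNormSq_eq_tsum]
    refine le_antisymm (iSup_le fun N => (min_le_right _ _).trans
      (mul_le_mul_right (ENNReal.sum_le_tsum _) _)) ?_
    rw [ENNReal.tsum_eq_iSup_sum, ENNReal.mul_iSup]
    refine iSup_le fun t => ?_
    obtain ⟨N₀, hN₀⟩ := hs_exhaust t
    have ha : C * ∑ k ∈ t, F u k ≠ ∞ :=
      ENNReal.mul_ne_top ENNReal.ofReal_ne_top (ENNReal.sum_ne_top.2 fun k _ => hF_ne_top u k)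
    obtain ⟨N₁, hN₁⟩ := ENNReal.exists_nat_gt ha
    refine le_iSup_of_le (max N₀ N₁) (le_min ?_ ?_)
    · exact hN₁.le.trans (by exact_mod_cast le_max_right N₀ N₁)
    · exact mul_le_mul_right
        (Finset.sum_le_sum_of_subset (hN₀.trans (hs_mono (le_max_left _ _)))) _

/-- **Lower semicontinuity of the mean enstrophy (any dimension).** The mean enstrophy
`μ ↦ ∫⁻ ‖∇u‖² dμ` is lower semicontinuous on `ProbabilityMeasure H` (weak convergence): it is
the supremum over `N` of the continuous maps `μ ↦ ∫⁻ g_N dμ`, `g_N` the bounded continuous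
truncations of `exists_continuous_monotone_iSup_eq_eGradNormSq` (monotone convergence).
[folklore] -/
theorem lowerSemicontinuous_ensembleEnstrophy {d : Type*} [Fintype d] [DecidableEq d] :
    LowerSemicontinuous fun μ : ProbabilityMeasure (Torus.energySpace d) =>
      Torus.ensembleEnstrophy (μ : Measure (Torus.energySpace d)) := by
  obtain ⟨g, hg_cont, hg_le, hg_mono, hg_sup⟩ :=
    exists_continuous_monotone_iSup_eq_eGradNormSq (d := d)
  have hne : ∀ N u, g N u ≠ ∞ := fun N u =>
    ne_top_of_le_ne_top (ENNReal.natCast_ne_top N) (hg_le N u)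
  -- monotone convergence: the mean enstrophy is the supremum of the truncated means
  have key : ∀ μ : Measure (Torus.energySpace d),
      Torus.ensembleEnstrophy μ = ⨆ N, ∫⁻ u, g N u ∂μ := fun μ => by
    rw [← lintegral_iSup (fun N => (hg_cont N).measurable) hg_mono]
    exact lintegral_congr fun u => (hg_sup u).symm
  -- each truncated mean is continuous in `μ`
  have hcont : ∀ N, Continuous fun μ : ProbabilityMeasure (Torus.energySpace d) =>
      ∫⁻ u, g N u ∂(μ : Measure (Torus.energySpace d)) := by
    intro N
    obtain ⟨fN, hfN⟩ : ∃ fN : Torus.energySpace d →ᵇ ℝ≥0, ∀ u, (fN u : ℝ≥0∞) = g N u := by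
      refine ⟨BoundedContinuousFunction.mkOfBound ⟨fun u => (g N u).toNNReal, ?_⟩ N ?_,
        fun u => ?_⟩
      · exact ENNReal.continuousOn_toNNReal.comp_continuous (hg_cont N) (hne N)
      · intro x y
        have hb : ∀ u, ((g N u).toNNReal : ℝ) ≤ N := fun u =>
          ENNReal.toReal_le_of_le_ofReal (Nat.cast_nonneg N)
            (by rw [ENNReal.ofReal_natCast]; exact hg_le N u)
        simp only [ContinuousMap.coe_mk, NNReal.dist_eq]
        rw [abs_sub_le_iff]
        exact ⟨by linarith [hb x, (g N y).toNNReal.coe_nonneg],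
          by linarith [hb y, (g N x).toNNReal.coe_nonneg]⟩
      · simp only [BoundedContinuousFunction.mkOfBound_coe, ContinuousMap.coe_mk]
        exact ENNReal.coe_toNNReal (hne N u)
    have h := ProbabilityMeasure.continuous_lintegral_boundedContinuousFunction fN
    simp only [hfN] at h
    exact h
  have h_eq : (fun μ : ProbabilityMeasure (Torus.energySpace d) =>
      Torus.ensembleEnstrophy (μ : Measure (Torus.energySpace d))) =
      fun μ : ProbabilityMeasure (Torus.energySpace d) =>
        ⨆ N, ∫⁻ u, g N u ∂(μ : Measure (Torus.energySpace d)) :=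
    funext fun μ => key μ
  rw [h_eq]
  exact lowerSemicontinuous_iSup fun N => (hcont N).lowerSemicontinuous

/-- **S0 `stub_lscEnstrophy`.** The mean enstrophy `μ ↦ ∫⁻ ‖∇u‖² dμ` is lower semicontinuous
on `ProbabilityMeasure H`, `H = Torus.energySpace (Fin 3)` (topology of weak convergence):
the three-dimensional case of `lowerSemicontinuous_ensembleEnstrophy`. -/
theorem stub_lscEnstrophy :
    LowerSemicontinuous fun μ : ProbabilityMeasure (Torus.energySpace (Fin 3)) =>
      Torus.ensembleEnstrophy (μ : Measure (Torus.energySpace (Fin 3))) :=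
  lowerSemicontinuous_ensembleEnstrophy

end Summit.AnomalousDissipation.AnomalousDissipation.Theorems.TaylorCertificatesFloorCertificate
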